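import Mathlib.NumberTheory.ArithmeticFunction.LFunction
import Mathlib.NumberTheory.LSeries.Basic
import Mathlib.Analysis.SpecialFunctions.Gamma.Deligne
import Mathlib.AlgebraicGeometry.EllipticCurve.LFunction
import Mathlib.NumberTheory.NumberField.InfinitePlace.Basic
import Mathlib.NumberTheory.NumberField.Discriminant.Defs
import Mathlib.Analysis.Meromorphic.Basic
import Mathlib.LinearAlgebra.Charpoly.Basic
import Mathlib.Algebra.Polynomial.Reverse
import Literature.AlgebraicGeometry.Motives.EtaleRealization
import Literature.AlgebraicGeometry.Motives.GoodReduction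
import Literature.AlgebraicGeometry.Motives.BaseChange
import Literature.AlgebraicGeometry.Motives.Varieties
import Literature.AlgebraicGeometry.Motives.HodgeStructure
import Literature.AlgebraicGeometry.Motives.BettiRealization
import Literature.AlgebraicGeometry.Motives.GaloisRealization
import Literature.NumberTheory.GaloisRepresentations.GaloisRep
import Literature.NumberTheory.GaloisRepresentations.ArtinConductor
import Literature.NumberTheory.GaloisRepresentations.ArtinLFunction
import Literature.NumberTheory.GaloisRepresentations.IntegralGaloisAction
import HarnessLib

-- provenance: harness21/H21/H21/Prelude/MotiveL/HasseWeil.lean @ d0522d9 (interim HEAD d8f2665); M5 mechanical rewrite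
/-!
# Hasse–Weil L-functions (trunk MotiveL, prelude C7; notions `hasse_weil_L_function`,
`etale_cohomology`)

Let `K` be a number field and `X` a smooth projective variety over `K`. Serre (1970) attaches
to the cohomology `Hⁱ(X)` in degree `i` (weight `w = i`):

* at each finite place `v` a local factor `P_v(T) = det(1 - F_v T | Hⁱ_ℓ(X_{K̄})^{I_v}) ∈ ℤ[T]`
  (`F_v` a **geometric** Frobenius, `I_v` the inertia group, `ℓ` prime to `v`; that `P_v` has
  integer coefficients independent of `ℓ` is Serre's hypothesis/conjecture C₇–C₈, a theorem
  at places of good reduction by Deligne), and the conductor exponent `f(v) = a_v(Hⁱ_ℓ)`;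
* at each infinite place `w` a `Γ`-factor built from the Hodge numbers `h^{p,q}` of
  `Hⁱ(X_σ(ℂ), ℂ)` (and, for real `w`, from the action of complex conjugation `F_∞` on `H^{p,p}`)
  out of `Γ_ℝ(s) = π^{-s/2} Γ(s/2)` and `Γ_ℂ(s) = 2 (2π)^{-s} Γ(s)` (Serre 1970, §3, (25)–(27));
* the L-function `L(Hⁱ, s) = ∏_v P_v(N v^{-s})⁻¹` (a Dirichlet series with integer
  coefficients, convergent for `re s > 1 + w/2`), the constant `A = N · |d_K|^{Bᵢ}` with
  `N = ∏_v N v^{f(v)}` and `Bᵢ = dim Hⁱ`, and the completed L-function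
  `Λ(s) = A^{s/2} Γ(s) L(s)`, conjectured (Serre 1970, §4.1, C₉; Deligne 1979, §1.2) to continue
  meromorphically to `ℂ` and to satisfy `Λ(s) = ε Λ(w + 1 - s)` with `|ε| = 1`.

## Design (OUTLINE C7)

Following Mathlib's `WeierstrassCurve.LFunction` (which builds the L-function of an elliptic
curve from the *numeric* local polynomials `WeierstrassCurve.localPolynomial ∈ ℤ[X]` via
`ArithmeticFunction.eulerProduct`, `ArithmeticFunction.ofPowerSeries` and
`PowerSeries.invOfUnit`), the analytic objects are built from an honest **numeric datum**
`Literature.HasseWeilData K` (weight, rank, integral local factors, conductor exponents, archimedean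
Hodge data) with no cohomology in it: `LFunction`, `LSeries`, `conductor`, `gammaFactor`,
`completedLFunction`, `HasMeromorphicContinuation` (the accepted G09 predicate
`Literature.NumberTheory.GaloisRepresentations.LFunction.HasMeromorphicContinuation` applied to the weight-shifted series
`L(s + w/2)`, whose region of convergence is `re s > 1`), `SatisfiesFunctionalEquation`.

That such a datum "is the Hasse–Weil datum of `Hⁱ(X)`" is the separate **matching predicate**
`Literature.IsHasseWeilDataFor hbc E Bℂ S X hX i D` against a family of étale realizations
`E ℓ : EtaleRealization K ℓ` (all primes `ℓ`), Betti–Hodge data `Bℂ : BettiHodgeData ℂ` and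
archimedean sign data `S : ArchSignData K`: the local factor at `v` maps to
`det(1 - F_v T | Hⁱ_ℓ(X)^{I_v})` for *every* `ℓ` with `v ∤ ℓ` (so `ℓ`-independence and
integrality, Serre's C₇/C₈, are hypotheses carried by the predicate, as intended), the
conductor exponent is G09's `GaloisRep.artinConductorExponent`, the rank is `dim Hⁱ_ℓ`, the
Hodge numbers at the place of `σ : K →+* ℂ` are those of the Hodge structure `Bℂ.hodge _ i` on
`Hⁱ(X_σ)`, and at real places the signs `h^{p,+}` are those of `S`.

**Why `S` (pitfall for consumers).** Serre's `Γ`-factor at a *real* place depends on the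
splitting `h^{p,p} = h^{p,+} + h^{p,-}` by the action of `F_∞` (complex conjugation on
`X_σ(ℂ)`) on `H^{p,p}`. The accepted `BettiHodgeData ℂ` carries no `F_∞` (only the coefficient
conjugation `HodgeStructure.conj`), so these signs cannot be derived from `(E, Bℂ)`; if they
were left free, two data `D₁, D₂` matching the same `Hⁱ(X)` could have different completed
L-functions (e.g. `H²(ℙ¹_ℚ)`: `Γ_ℝ(s-1)ζ(s-1)` vs `Γ_ℝ(s)ζ(s-1)`, only the first satisfying a
functional equation), and any statement of the form `∀ D, IsHasseWeilDataFor … D → (functional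
equation)` would be refutable. Hence the missing `F_∞`-information is an explicit hypothesis
parameter `S`, exactly as `E` and `Bℂ` are, and the predicate pins `h^{p,+}` at real places to
it (`h^{p,-}` follows from the sum rule; complex places do not use `h^{p,±}`); see
`IsHasseWeilDataFor.gammaFactor_eq`.

## Frobenius conventions (OUTLINE §1(d)) — read this

The accepted GalRep trunk (G09) uses the **arithmetic** Frobenius: `GaloisRep.frobCharpoly`,
`ArtinRep.eulerPolynomial`/`ArtinRep.eulerFactorAt` are characteristic polynomials of `ρ(σ)`
with `IsArithFrobAt (𝓞 K) σ 𝔓` (`σ x ≡ x^{N v}`). Serre's local factors of `Hⁱ(X)` and the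
Lefschetz trace formula need the **geometric** Frobenius `F_v = σ⁻¹`
(`Literature.IsGeomFrobAt (𝓞 K) σ 𝔓 := IsArithFrobAt (𝓞 K) σ⁻¹ 𝔓`, accepted C3). This file therefore
defines its own `Literature.GaloisRep.geomEulerFactorAt ρ v = det(1 - T ρ(F_v) | M^{I_𝔓})`, of exactly
the same shape as `ArtinRep.eulerFactorAt` (chosen `𝔓 ∣ v`, chosen Frobenius, restriction to
the inertia invariants `ContinuousRep.restrictInertiaInvariants`, `LinearMap.charpoly`,
`Polynomial.reverse`, junk value `1`) but with `IsGeomFrobAt`. **Nothing in this file is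
identified with `GaloisRep.frobCharpoly` or its reverse**: `geomEulerFactorAt ρ v` is the
reverse characteristic polynomial of `ρ(σ⁻¹)`, not of `ρ(σ)`, and the two differ in general
(they agree after `ρ ↦ ρ^∨`).

## Main definitions

* `Literature.AlgebraicGeometry.Motives.HodgeGammaDatum`, `HodgeGammaDatum.rank`, `HodgeGammaDatum.gammaFactorReal`,
  `HodgeGammaDatum.gammaFactorComplex` : archimedean Hodge data and Serre's `Γ`-factors.
* `Literature.HasseWeilData K` and its API `LFunction`, `LSeries`, `conductor`, `gammaFactor`,
  `completedLFunction`, `HasMeromorphicContinuation`, `SatisfiesFunctionalEquation`.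
* `Literature.NumberTheory.GaloisRepresentations.GaloisRep.geomEulerFactorAt`, `geomEulerFactorAt_coeff_zero`, and the named fact
  `geomEulerFactorAt_spec` (D-0014: `def … : Prop`, usage `(h : ρ.geomEulerFactorAt_spec)`).
* `Literature.EtaleRealization.localEulerFactorAt E X i v : ℚ_[ℓ][X]`.
* `Literature.ArchSignData K` : the `F_∞`-signs `h^{p,+}` (hypothesis structure).
* `Literature.IsHasseWeilDataFor hbc E Bℂ S X hX i D : Prop`, `IsHasseWeilDataFor.gammaFactor_eq`
  (proved).

## Downstream note (M5 migration)

* `IsHasseWeilDataFor` takes, as a new first explicit argument, the upstream named fact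
  `hbc : IsSmoothProjective.baseChangeHom (k := K) (L := ℂ)` (`BaseChange.lean`; smooth
  projective varieties are stable under base change along `σ : K →+* ℂ`), which supplies the
  smoothness witness `hbc σ hX` of `X_σ` consumed by `Bℂ.hodge` — the same threading as the
  field `smoothProjective_baseChange` of `PeriodComparison`.  Consumers
  (`LangHasseWeil.isHasseWeilDataFor_iff`, `HasseWeilConjecture`) add the parameter `hbc` and
  replace `hX.baseChangeHom σ` by `hbc σ hX`.
* `GaloisRep.geomEulerFactorAt_spec` is a named fact: in `LangHasseWeil`,
  `localEulerFactorAt_eq_of_isGeomFrobAt` takes `(h : (E.galoisRep X i).geomEulerFactorAt_spec)`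
  and concludes `h h𝔓 hσ`.

## Mathlib search

Mathlib (this pin) has `Complex.Gammaℝ`, `Complex.Gammaℂ` (`Analysis/SpecialFunctions/Gamma/
Deligne.lean`), `ArithmeticFunction.eulerProduct`, `ArithmeticFunction.ofPowerSeries`
(`NumberTheory/ArithmeticFunction/LFunction.lean`), `PowerSeries.invOfUnit`, `LSeries`,
`NumberField.discr`, `NumberField.InfinitePlace` (`IsReal`, `mk`), `Meromorphic`,
`LinearMap.charpoly`, `Polynomial.reverse`, `Ideal.ResidueField`, and the elliptic-curve
instance of the whole construction `WeierstrassCurve.localPolynomial/LFunction/LSeries`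
(`AlgebraicGeometry/EllipticCurve/LFunction.lean`), all used or imitated here. It has no
Hasse–Weil L-function of a variety or motive, no Serre `Γ`-factor of a Hodge structure and no
Euler factor of a Galois representation (grep `HasseWeil`, `Gamma.*hodge`, `eulerFactor`).
The accepted H21 file `Prelude/EllArithM/HasseWeilAbelian.lean` treats the *homological*
`H₁ = V_ℓ` of abelian varieties (arithmetic Frobenius on inertia coinvariants); the present file
is the cohomological, all-degrees version and does not depend on it.

## Further design notes

* `K : Type` (universe `0`) throughout: the Betti side `BettiHodgeData ℂ` and `baseChangeHom σ`
  (`σ : K →+* ℂ`) force `K` and `ℂ` into one universe (OUTLINE §1(a), review 11).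
* `[NumberField K]` from `LFunction` on (as in Mathlib's `WeierstrassCurve.LFunction`; review 2):
  `LFunction` uses `q_v = v.residueCard = Ideal.absNorm v` (accepted C3), which is
  `Nat.card v.asIdeal.ResidueField` (the literal Mathlib form) by the accepted C6
  `IsDedekindDomain.HeightOneSpectrum.natCard_residueField`; see
  `LFunction_eq_eulerProduct_natCard`.
* `completedLFunction` uses `A = conductor · |d_K| ^ rank` (Serre 1970, §4.1 (29):
  `A = N · |d|^{Bᵢ}`), the exponent `Bᵢ` being the explicit field `HasseWeilData.rank`
  (tied to the data by `natDegree_localFactor_le` and `rank_gammaData`; review 14).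
* Junk values: `geomEulerFactorAt` is `1` if no (prime, geometric Frobenius) pair exists (never
  for a number field) or if `M^{I_𝔓}` is not finite-dimensional (documented; consumers assume
  `Module.Finite`). `LSeries`/`completedLFunction` are genuine only in the half-plane of
  convergence; continuation is expressed by predicates, as in G09.

## References

* J.-P. Serre, *Facteurs locaux des fonctions zêta des variétés algébriques (définitions et
  conjectures)*, Sém. Delange–Pisot–Poitou 11 (1969/70), exp. 19, §§2–4.
* P. Deligne, *Valeurs de fonctions L et périodes d'intégrales*, PSPM 33 (Corvallis 1979),
  part 2, §1.2.
* P. Deligne, *Les constantes des équations fonctionnelles des fonctions L* (Antwerp II, 1973),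
  §8 (geometric Frobenius).
-/

universe v w

open scoped NumberField Polynomial
open Field IsDedekindDomain Module NumberField ArithmeticFunction

noncomputable section

namespace Literature.AlgebraicGeometry.Motives

/-! ### Archimedean Hodge data and Serre's `Γ`-factors -/

/-- **Archimedean Hodge datum** at one infinite place (Serre 1970, §3.1–3.2): the Hodge numbers
`h^{p,q} = hodge (p, q)` of `V = Hⁱ(X_σ(ℂ), ℂ) = ⊕ V^{p,q}` (finitely supported, symmetric
`h^{p,q} = h^{q,p}`), together with the splitting `h^{p,p} = h^{p,+} + h^{p,-}` of the diagonal
Hodge numbers used at *real* places, where (Serre's parity rule, *loc. cit.* §3.2 (b))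
`h^{p,±} = dim {x ∈ V^{p,p} | F_∞ x = ±(-1)^p x}` for the involution `F_∞` induced by complex
conjugation on `X_σ(ℂ)`. At a complex place `hPlus`/`hMinus` are not used by the `Γ`-factor. [cite: Serre1970, §3.1–3.2] -/
structure HodgeGammaDatum where
  /-- The Hodge numbers `(p, q) ↦ h^{p,q}`, finitely supported. -/
  hodge : ℤ × ℤ →₀ ℕ
  /-- Hodge symmetry `h^{p,q} = h^{q,p}`. -/
  hodge_symm : ∀ p q : ℤ, hodge (p, q) = hodge (q, p)
  /-- `p ↦ h^{p,+} = dim {x ∈ V^{p,p} | F_∞ x = (-1)^p x}`. -/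
  hPlus : ℤ →₀ ℕ
  /-- `p ↦ h^{p,-} = dim {x ∈ V^{p,p} | F_∞ x = -(-1)^p x}`. -/
  hMinus : ℤ →₀ ℕ
  /-- The sum rule `h^{p,+} + h^{p,-} = h^{p,p}`. -/
  hPlus_add_hMinus : ∀ p : ℤ, hPlus p + hMinus p = hodge (p, p)

namespace HodgeGammaDatum

/-- The rank `∑_{p,q} h^{p,q} = dim V` of an archimedean Hodge datum (Serre 1970, §3.1). [cite: Serre1970, §3.1] -/
def rank (D : HodgeGammaDatum) : ℕ :=
  D.hodge.sum fun _ n ↦ n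

/-- Serre's `Γ`-factor at a **complex** place (Serre 1970, §3.2 (a), formula (25)):
`Γ_V(s) = ∏_{(p,q)} Γ_ℂ(s - min(p,q))^{h^{p,q}}`, product over *all* pairs `(p, q)`
(so a pair `p < q` and its mirror `q < p` both contribute `Γ_ℂ(s - p)^{h^{p,q}}`), with Mathlib's
`Complex.Gammaℂ s = 2 (2π)^{-s} Γ(s)`. [cite: Serre1970, §3.2 (a] -/
def gammaFactorComplex (D : HodgeGammaDatum) (s : ℂ) : ℂ :=
  D.hodge.prod fun pq n ↦ Complex.Gammaℂ (s - ((min pq.1 pq.2 : ℤ) : ℂ)) ^ n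

/-- Serre's `Γ`-factor at a **real** place (Serre 1970, §3.2 (b), formulas (26)–(27)):
`Γ_V(s) = ∏_{p<q} Γ_ℂ(s - p)^{h^{p,q}} · ∏_p Γ_ℝ(s - p)^{h^{p,+}} Γ_ℝ(s - p + 1)^{h^{p,-}}`, where
`h^{p,±} = dim {x ∈ V^{p,p} | F_∞ x = ±(-1)^p x}` (parity rule) and
`Γ_ℝ(s) = π^{-s/2} Γ(s/2)` (`Complex.Gammaℝ`), `Γ_ℂ(s) = 2 (2π)^{-s} Γ(s)` (`Complex.Gammaℂ`).
Sanity: `H⁰(pt)` gives `Γ_ℝ(s)` (Riemann zeta); `H²(ℙ¹)` over `ℚ` (`F_∞ = -1` on `H^{1,1}`,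
so `h^{1,+} = 1`) gives `Γ_ℝ(s - 1)`, the factor of `ζ(s - 1)`. [cite: Serre1970, §3.2 (b] -/
def gammaFactorReal (D : HodgeGammaDatum) (s : ℂ) : ℂ :=
  (D.hodge.prod fun pq n ↦
      if pq.1 < pq.2 then Complex.Gammaℂ (s - ((pq.1 : ℤ) : ℂ)) ^ n else 1) *
    (D.hPlus.prod fun p n ↦ Complex.Gammaℝ (s - (p : ℂ)) ^ n) *
    D.hMinus.prod fun p n ↦ Complex.Gammaℝ (s - (p : ℂ) + 1) ^ n

end HodgeGammaDatum

/-! ### Numeric Hasse–Weil data and the associated analytic objects -/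

section Numeric

variable (K : Type) [Field K]

/-- **Numeric Hasse–Weil data** over the number field `K` (hypothesis structure; Serre 1970,
§§2–4): a weight `w`, a rank `B` (`= Bᵢ = dim Hⁱ`), an integral local factor
`P_v ∈ ℤ[T]` with `P_v(0) = 1` and `deg P_v ≤ B` at every finite place `v`, finitely supported
conductor exponents `f(v)`, and an archimedean Hodge datum of rank `B` at every infinite place.
No cohomology enters: that these data come from `Hⁱ(X)` is the predicate `IsHasseWeilDataFor`.
This is the pattern of Mathlib's `WeierstrassCurve.LFunction` (numeric `localPolynomial`). [cite: Serre1970, §§2–4] -/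
structure HasseWeilData where
  /-- The weight `w` (`= i` for `Hⁱ(X)`; Serre 1970, §2.2). -/
  weight : ℕ
  /-- The rank `B = Bᵢ = dim Hⁱ(X)` (Serre 1970, §4.1). -/
  rank : ℕ
  /-- The local factor `P_v(T) ∈ ℤ[T]` at the finite place `v` (Serre 1970, §2.2, hypothesis
  C₇: integral and independent of `ℓ`). -/
  localFactor : HeightOneSpectrum (𝓞 K) → ℤ[X]
  /-- `P_v(0) = 1`. -/
  coeff_zero_localFactor : ∀ v, (localFactor v).coeff 0 = 1
  /-- `deg P_v ≤ B` (with equality at unramified places). -/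
  natDegree_localFactor_le : ∀ v, (localFactor v).natDegree ≤ rank
  /-- The conductor exponents `v ↦ f(v)`, zero for almost all `v` (Serre 1970, §2.1, §4.1). -/
  conductorExp : HeightOneSpectrum (𝓞 K) →₀ ℕ
  /-- The archimedean Hodge datum at each infinite place (Serre 1970, §3). -/
  gammaData : InfinitePlace K → HodgeGammaDatum
  /-- Each archimedean Hodge datum has rank `B`. -/
  rank_gammaData : ∀ w, (gammaData w).rank = rank

variable {K}

namespace HasseWeilData

variable [NumberField K]

/-- The **Hasse–Weil L-function as a formal Dirichlet series** with integer coefficients: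
the Euler product (Mathlib `ArithmeticFunction.eulerProduct`) over the finite places `v` of the
arithmetic functions supported on powers of `q_v = N v = v.residueCard` (accepted C3
`IsDedekindDomain.HeightOneSpectrum.residueCard = Ideal.absNorm v.asIdeal > 1`, so
`ofPowerSeries` is never in its junk branch) with coefficients the power series `1 / P_v(T)`
(`PowerSeries.invOfUnit _ 1`, legitimate since `P_v(0) = 1`). The pattern of Mathlib's
`WeierstrassCurve.LFunction` (stated, like it, for a number field `K`); the literal Mathlib form
with `Nat.card v.asIdeal.ResidueField` is `LFunction_eq_eulerProduct_natCard`.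
Ref: Serre 1970, §2.2 (`L(Hⁱ, s) = ∏_v P_v(N v^{-s})⁻¹`). [cite: Serre1970, §2.2 ( L(Hⁱ  s] -/
def LFunction (D : HasseWeilData K) : ArithmeticFunction ℤ :=
  eulerProduct fun v : HeightOneSpectrum (𝓞 K) ↦
    ofPowerSeries v.residueCard (PowerSeries.invOfUnit (D.localFactor v) 1)

/-- `LFunction` in the literal form of Mathlib's `WeierstrassCurve.LFunction`, with
`Nat.card κ(v)` (`= v.residueCard` by the accepted C6 `Literature.AlgebraicGeometry.Motives.natCard_residueField`).
Ref: Serre 1970, §2.2. [cite: Serre1970, §2.2] -/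
theorem LFunction_eq_eulerProduct_natCard (D : HasseWeilData K) :
    D.LFunction = eulerProduct fun v : HeightOneSpectrum (𝓞 K) ↦
      ofPowerSeries (Nat.card v.asIdeal.ResidueField)
        (PowerSeries.invOfUnit (D.localFactor v) 1) := by
  simp only [LFunction, natCard_residueField]

/-- The **Hasse–Weil L-series** `L(D, s) = ∑_n a_n n^{-s}` (Mathlib `LSeries` of the coefficients
of `D.LFunction`), convergent for `re s > 1 + w/2` under the Weil bounds; junk (the value of a
possibly divergent `tsum`) elsewhere. Pattern of `WeierstrassCurve.LSeries`.
Ref: Serre 1970, §2.2 and §4.1. [cite: Serre1970, §2.2 and §4.1] -/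
protected def LSeries (D : HasseWeilData K) (s : ℂ) : ℂ :=
  _root_.LSeries (fun n ↦ (D.LFunction n : ℂ)) s

/-- **Meromorphic continuation** of the Hasse–Weil L-series (Serre 1970, §4.1, conjecture C₉,
first half): the weight-shifted series `s ↦ L(D, s + w/2)`, which converges for `re s > 1`,
has meromorphic continuation to `ℂ` in the sense of the accepted G09 predicate
`Literature.NumberTheory.GaloisRepresentations.LFunction.HasMeromorphicContinuation` (agreement on `re s > 1`). [cite: Serre1970, §4.1  conjecture C₉  first half] -/
def HasMeromorphicContinuation (D : HasseWeilData K) : Prop :=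
  Literature.NumberTheory.GaloisRepresentations.LFunction.HasMeromorphicContinuation fun s ↦ D.LSeries (s + (D.weight : ℂ) / 2)

/-- Unfolding lemma for `HasMeromorphicContinuation`. Ref: Serre 1970, §4.1. [cite: Serre1970, §4.1] -/
theorem hasMeromorphicContinuation_iff (D : HasseWeilData K) :
    D.HasMeromorphicContinuation ↔
      Literature.NumberTheory.GaloisRepresentations.LFunction.HasMeromorphicContinuation fun s ↦ D.LSeries (s + (D.weight : ℂ) / 2) :=
  Iff.rfl

/-- The **conductor** `N = ∏_v N v^{f(v)} : ℕ` (a finite product, `∏ᶠ`, since `conductorExp` is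
finitely supported). Ref: Serre 1970, §2.1 and §4.1 (28). [cite: Serre1970, §2.1 and §4.1 (28] -/
def conductor (D : HasseWeilData K) : ℕ :=
  ∏ᶠ v : HeightOneSpectrum (𝓞 K), v.residueCard ^ D.conductorExp v

/-- The **archimedean `Γ`-factor** `Γ(D, s) = ∏_{w ∣ ∞} Γ_w(s)`: Serre's real factor
`HodgeGammaDatum.gammaFactorReal` at real places and complex factor
`HodgeGammaDatum.gammaFactorComplex` at complex places (Mathlib `NumberField.InfinitePlace`,
`InfinitePlace.IsReal`). Ref: Serre 1970, §3.2–3.3. [cite: Serre1970, §3.2–3.3] -/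
def gammaFactor (D : HasseWeilData K) (s : ℂ) : ℂ :=
  open scoped Classical in
  ∏ w : InfinitePlace K,
    if w.IsReal then (D.gammaData w).gammaFactorReal s else (D.gammaData w).gammaFactorComplex s

/-- The **completed Hasse–Weil L-function** `Λ(D, s) = A^{s/2} Γ(D, s) L(D, s)` with
`A = N · |d_K|^{B}` (Serre 1970, §4.1 (29): the conductor times the `Bᵢ`-th power of the
absolute discriminant, `Bᵢ = D.rank`; Mathlib `NumberField.discr`). Genuine value in the
half-plane of convergence of `D.LSeries`. Junk elsewhere; note also that Mathlib's
`Complex.Gamma` is `0` at its poles, so `gammaFactor` (hence this function) is `0` there —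
harmless, since for pure weight-`w` data (`h^{p,q} = 0` unless `p + q = w`) every such point has
`re s ≤ w/2`, outside the half-plane `re s > w/2 + 1` where the value is consumed.
Ref: Serre 1970, §4.1; Deligne 1979, §1.2. [cite: Serre1970, §4.1 (29] -/
def completedLFunction (D : HasseWeilData K) (s : ℂ) : ℂ :=
  ((D.conductor : ℂ) * ((NumberField.discr K).natAbs : ℂ) ^ D.rank) ^ (s / 2) *
    D.gammaFactor s * D.LSeries s

/-- **Functional equation** with constant `ε` (Serre 1970, §4.1, conjecture C₉, second half;
Deligne 1979, §1.2): there is a function `Λ` meromorphic on all of `ℂ` (Mathlib `Meromorphic`,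
i.e. `MeromorphicOn Λ univ`) agreeing with `D.completedLFunction` on the half-plane of
convergence `re s > w/2 + 1` and satisfying `Λ(s) = ε · Λ(w + 1 - s)` for all `s`.
Serre's C₉ has `ε = ±1` (`Hⁱ(X)` is self-dual up to twist by Poincaré duality); following
Deligne we allow an arbitrary constant `ε : ℂ` here (consumers ask `‖ε‖ = 1`), a documented
weakening. The agreement region and its mirror image are disjoint, so the predicate is not
vacuous, and `ε = 0` would force `Λ = 0`. [cite: Serre1970, §4.1  conjecture C₉  second half] -/
def SatisfiesFunctionalEquation (D : HasseWeilData K) (ε : ℂ) : Prop :=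
  ∃ Λ : ℂ → ℂ, Meromorphic Λ ∧
    (∀ s : ℂ, (D.weight : ℝ) / 2 + 1 < s.re → Λ s = D.completedLFunction s) ∧
    ∀ s : ℂ, Λ s = ε * Λ ((D.weight : ℂ) + 1 - s)

/-- A functional equation yields meromorphic continuation of the *completed* L-function from
`re s > w/2 + 1`, i.e. of `s ↦ Λ(D, s + w/2)` from `re s > 1` (projection of the witness).
Ref: Serre 1970, §4.1. [cite: Serre1970, §4.1] -/
theorem SatisfiesFunctionalEquation.hasMeromorphicContinuation_completedLFunction
    {D : HasseWeilData K} {ε : ℂ} (h : D.SatisfiesFunctionalEquation ε) :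
    Literature.NumberTheory.GaloisRepresentations.LFunction.HasMeromorphicContinuation
      fun s ↦ D.completedLFunction (s + (D.weight : ℂ) / 2) := by
  obtain ⟨Λ, hΛ, hagree, -⟩ := h
  refine ⟨fun s ↦ Λ (s + (D.weight : ℂ) / 2), fun x ↦ ?_, fun s hs ↦ hagree _ ?_⟩
  · exact (hΛ _).comp_analyticAt (analyticAt_id.add analyticAt_const)
  · simp only [Complex.add_re, Complex.div_ofNat_re, Complex.natCast_re]
    linarith

end HasseWeilData

end Numeric

/-! ### Matching layer: geometric-Frobenius Euler factors of Galois representations -/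

/-- A geometric Frobenius at a prime `𝔓` lies in the decomposition group `D_𝔓`
(`Ideal.decompositionSubgroup`, accepted C3), since its inverse, an arithmetic Frobenius, does
(Mathlib `IsArithFrobAt.mem_stabilizer`). A general C3-level helper, kept here to avoid touching
the accepted `GalRep/IntegralGaloisAction.lean`; candidate to move next to `IsGeomFrobAt`.
Ref: Neukirch, *Algebraic Number Theory*, Ch. I §9, (9.6); Deligne 1973, §8. [cite: Deligne1973, §8] -/
theorem _root_.Literature.NumberTheory.GaloisRepresentations.IsGeomFrobAt.mem_decompositionSubgroup {R S G : Type*} [CommRing R] [CommRing S]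
    [Algebra R S] [Group G] [MulSemiringAction G S] [SMulCommClass G R S] {𝔓 : Ideal S}
    [𝔓.IsPrime] {σ : G} (hσ : Literature.NumberTheory.GaloisRepresentations.IsGeomFrobAt R σ 𝔓) : σ ∈ 𝔓.decompositionSubgroup G := by
  simpa using (hσ : IsArithFrobAt R _ _).mem_stabilizer

section GaloisRep
open Literature.NumberTheory.GaloisRepresentations (GaloisRep)
open Literature.NumberTheory.GaloisRepresentations.GaloisRep

section EulerFactor

variable {K : Type} [Field K] {A : Type v} [Field A] [TopologicalSpace A]
  {M : Type w} [AddCommGroup M] [Module A M] [TopologicalSpace M]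

open scoped Classical in
/-- The **geometric-Frobenius Euler factor** `det(1 - T · ρ(F_v) | M^{I_𝔓}) ∈ A[T]` of the Galois
representation `ρ` at the finite place `v`, for a chosen prime `𝔓 ∣ v` of `\bar ℤ_K` and a
chosen **geometric** Frobenius `F_v = σ` at `𝔓` (`Literature.IsGeomFrobAt (𝓞 K) σ 𝔓`, i.e. `σ⁻¹` is an
arithmetic Frobenius; `σ ∈ D_𝔓` since `σ⁻¹ ∈ D_𝔓` by `IsArithFrobAt.mem_stabilizer`): the
reverse of the characteristic polynomial of `ρ.restrictInertiaInvariants 𝔓 ⟨σ, _⟩`. Exactly the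
shape of the accepted `ArtinRep.eulerFactorAt` with `IsGeomFrobAt` in place of `IsArithFrobAt`
(OUTLINE §1(d)); **not** related here to `GaloisRep.frobCharpoly`. Junk value `1` if no pair
`(𝔓, σ)` exists (never for a number field) or if `M^{I_𝔓}` is not finite-dimensional over `A`.
Independence of the choices: the named fact `geomEulerFactorAt_spec`.
Ref: Serre 1970, §2.2 (`P_v(T) = det(1 - F_v T | Hⁱ_ℓ^{I_v})`); Deligne 1973, §8. [cite: Serre1970, §2.2 ( P_v(T] -/
def _root_.Literature.NumberTheory.GaloisRepresentations.GaloisRep.geomEulerFactorAt (ρ : GaloisRep K A M) (v : HeightOneSpectrum (𝓞 K)) : A[X] :=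
  if h : ∃ 𝔓σ : Ideal (Literature.NumberTheory.GaloisRepresentations.absIntegers (𝓞 K) K) × absoluteGaloisGroup K,
      𝔓σ.1 ∈ v.primesAbove ∧ Literature.NumberTheory.GaloisRepresentations.IsGeomFrobAt (𝓞 K) 𝔓σ.2 𝔓σ.1 then
    if _hf : Module.Finite A (ρ.fixedSubmodule (h.choose.1.inertia (absoluteGaloisGroup K))) then
      (ρ.restrictInertiaInvariants h.choose.1
        ⟨h.choose.2, by
          haveI := h.choose_spec.1.1
          exact h.choose_spec.2.mem_decompositionSubgroup⟩).charpoly.reverse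
    else 1
  else 1

/-- The geometric Euler factor has constant term `1` (in every branch of the definition).
Ref: Serre 1970, §2.2. [cite: Serre1970, §2.2] -/
theorem _root_.Literature.NumberTheory.GaloisRepresentations.GaloisRep.geomEulerFactorAt_coeff_zero (ρ : GaloisRep K A M) (v : HeightOneSpectrum (𝓞 K)) :
    (ρ.geomEulerFactorAt v).coeff 0 = 1 := by
  unfold geomEulerFactorAt
  split_ifs with h hf
  · rw [Polynomial.coeff_zero_reverse, (LinearMap.charpoly_monic _).leadingCoeff]
  · simp
  · simp

/-- Specification of `geomEulerFactorAt` (independence of the choices): for a number field `K`,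
*every* prime `𝔓 ∣ v` and *every* geometric Frobenius `σ` at `𝔓` with `M^{I_𝔓}`
finite-dimensional, `geomEulerFactorAt ρ v = det(1 - T ρ(σ) | M^{I_𝔓})` (primes above `v` are
conjugate; geometric Frobenii form an `I_𝔓`-coset and `I_𝔓` acts trivially on `M^{I_𝔓}`).
Named fact (D-0014), one per representation `ρ`: usage `(h : ρ.geomEulerFactorAt_spec)`,
then `h h𝔓 hσ`.
Ref: Serre 1970, §2.2; Neukirch, *Algebraic Number Theory*, Ch. VII §10. [cite: Serre1970, §2.2] -/
def _root_.Literature.NumberTheory.GaloisRepresentations.GaloisRep.geomEulerFactorAt_spec [NumberField K] (ρ : GaloisRep K A M) : Prop :=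
  ∀ ⦃v : HeightOneSpectrum (𝓞 K)⦄ ⦃𝔓 : Ideal (Literature.NumberTheory.GaloisRepresentations.absIntegers (𝓞 K) K)⦄ (h𝔓 : 𝔓 ∈ v.primesAbove)
    ⦃σ : absoluteGaloisGroup K⦄ (hσ : Literature.NumberTheory.GaloisRepresentations.IsGeomFrobAt (𝓞 K) σ 𝔓)
    [Module.Finite A (ρ.fixedSubmodule (𝔓.inertia (absoluteGaloisGroup K)))],
    ρ.geomEulerFactorAt v =
      (ρ.restrictInertiaInvariants 𝔓
        ⟨σ, by haveI := h𝔓.1; exact hσ.mem_decompositionSubgroup⟩).charpoly.reverse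

end EulerFactor

end GaloisRep

/-! ### Matching layer: local factors of the étale realization and the matching predicate -/

namespace EtaleRealization

variable {K : Type} [Field K] {ℓ : ℕ} [Fact ℓ.Prime]

/-- The **local Euler factor** `P_v(Hⁱ_ℓ(X), T) = det(1 - F_v T | Hⁱ_ℓ(X)^{I_v}) ∈ ℚ_ℓ[T]` of the
étale realization in degree `i` at the finite place `v` (geometric Frobenius on the inertia
invariants of `E.galoisRep X i`; `GaloisRep.geomEulerFactorAt`). Meaningful for `v ∤ ℓ`.
Ref: Serre 1970, §2.2. [cite: Serre1970, §2.2] -/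
def localEulerFactorAt (E : EtaleRealization K ℓ) (X : SchemeOver K) (i : ℕ)
    (v : HeightOneSpectrum (𝓞 K)) : ℚ_[ℓ][X] :=
  (E.galoisRep X i).geomEulerFactorAt v

/-- The local Euler factor of the étale realization has constant term `1`.
Ref: Serre 1970, §2.2. [cite: Serre1970, §2.2] -/
theorem localEulerFactorAt_coeff_zero (E : EtaleRealization K ℓ) (X : SchemeOver K) (i : ℕ)
    (v : HeightOneSpectrum (𝓞 K)) : (E.localEulerFactorAt X i v).coeff 0 = 1 :=
  Literature.NumberTheory.GaloisRepresentations.GaloisRep.geomEulerFactorAt_coeff_zero _ _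

end EtaleRealization

section Matching

variable (K : Type) [Field K]

/-- **Archimedean sign data** (hypothesis structure; Serre 1970, §3.2 (b)): for every complex
embedding `σ : K →+* ℂ`, every smooth projective `X/K`, every degree `i` and every `p`, the
number `hPlus σ hX i p = h^{p,+} = dim {x ∈ H^{p,p}(X_σ(ℂ)) | F_∞ x = (-1)^p x}`, where `F_∞` is
the involution of `Hⁱ(X_σ(ℂ), ℂ)` induced by complex conjugation on the points `X_σ(ℂ)` (only
meaningful, and only consumed, when `σ` is real, so that conjugation acts on `X_σ(ℂ)`). This is
the piece of archimedean information that determines Serre's `Γ`-factor at a real place and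
that the accepted Betti–Hodge data `BettiHodgeData ℂ` (which carries only the coefficient
conjugation `HodgeStructure.conj`, not `F_∞`) cannot supply; it is therefore an explicit
parameter of the matching predicate `IsHasseWeilDataFor`, on a par with the realizations
`E` and `Bℂ` (OUTLINE §4). The complementary `h^{p,-}` is `h^{p,p} - h^{p,+}` (sum rule of
`HodgeGammaDatum`). [cite: Serre1970, §3.2 (b] -/
structure ArchSignData where
  /-- `hPlus σ hX i p = dim {x ∈ H^{p,p}(X_σ(ℂ)) | F_∞ x = (-1)^p x}` (Serre 1970, §3.2 (b)). -/
  hPlus : ∀ (_σ : K →+* ℂ) ⦃n : ℕ⦄ ⦃X : SchemeOver K⦄, IsSmoothProjective n X → ℕ → ℤ → ℕ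

variable {K} [NumberField K]

/-- **Matching predicate**: the numeric datum `D` *is the Hasse–Weil datum of `Hⁱ(X)`* for the
smooth projective `X/K`, with respect to étale realizations `E ℓ` (all primes `ℓ`),
Betti–Hodge data `Bℂ` over `ℂ` and archimedean sign data `S` (Serre 1970, §§2–4):
* the weight is `i`;
* for every `ℓ`, the rank is `dim_{ℚ_ℓ} Hⁱ_ℓ(X)`;
* for every `ℓ` and every finite place `v ∤ ℓ`, `P_v` (mapped to `ℚ_ℓ[T]`) is
  `det(1 - F_v T | Hⁱ_ℓ(X)^{I_v})` (`EtaleRealization.localEulerFactorAt`) and `f(v)` is the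
  Artin conductor exponent of `Hⁱ_ℓ(X)` at `v` (G09 `GaloisRep.artinConductorExponent`) — in
  particular `ℓ`-independence and integrality (Serre's C₇, C₈) are part of the hypothesis
  (the guard `v ∤ ℓ` also avoids the documented junk of `artinConductorExponent` at `v ∣ ℓ`;
  every `v` is covered by some `ℓ`);
* for every embedding `σ : K →+* ℂ` the Hodge numbers of the archimedean datum at the place of
  `σ` are those of the Hodge structure `Bℂ.hodge (hbc σ hX) i` on `Hⁱ(X_σ)`,
  `X_σ = (baseChangeHom σ).obj X`, smooth projective of dimension `n` by the upstream named fact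
  `hbc : IsSmoothProjective.baseChangeHom` (`BaseChange.lean`; Hartshorne III.10.1(b),
  II.4.8(c)), threaded as an explicit hypothesis parameter (consistent for `σ` and `σ̄`, which
  define the same place, by Hodge symmetry);
* for every **real** embedding `σ` the signs `h^{p,+}` of the archimedean datum at the place of
  `σ` are `S.hPlus σ hX i p` (and then `h^{p,-}` is forced by the sum rule of `HodgeGammaDatum`);
  at complex places `h^{p,±}` are not consumed by the `Γ`-factor and are left free.
Consequently all data `D` matching a given `(E, Bℂ, S, X, i)` have the same `LSeries`, `conductor`,
`gammaFactor` and `completedLFunction`, so that consumers may quantify `∀ D, IsHasseWeilDataFor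
… D → …` (as **lang.S06** does) without the statement becoming refutable through a wrong choice
of archimedean signs (review of v0: with `h^{p,±}` free, `H²(ℙ¹_ℚ)` admits both `Γ_ℝ(s-1)` and
`Γ_ℝ(s)` as `Γ`-factor and only the first satisfies a functional equation). [cite: Serre1970, §§2–4] -/
def IsHasseWeilDataFor (hbc : IsSmoothProjective.baseChangeHom (k := K) (L := ℂ))
    (E : ∀ (ℓ : ℕ) [Fact ℓ.Prime], EtaleRealization K ℓ)
    (Bℂ : BettiHodgeData ℂ) (S : ArchSignData K) ⦃n : ℕ⦄ (X : SchemeOver K)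
    (hX : IsSmoothProjective n X) (i : ℕ) (D : HasseWeilData K) : Prop :=
  D.weight = i ∧
    (∀ (ℓ : ℕ) [Fact ℓ.Prime], D.rank = finrank ℚ_[ℓ] ((E ℓ).V X i)) ∧
    (∀ (ℓ : ℕ) [Fact ℓ.Prime] (v : HeightOneSpectrum (𝓞 K)), (ℓ : 𝓞 K) ∉ v.asIdeal →
      (D.localFactor v).map (Int.castRingHom ℚ_[ℓ]) = (E ℓ).localEulerFactorAt X i v ∧
        D.conductorExp v = Literature.NumberTheory.GaloisRepresentations.GaloisRep.artinConductorExponent v ((E ℓ).galoisRep X i)) ∧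
    (∀ (σ : K →+* ℂ) (p q : ℤ), (D.gammaData (InfinitePlace.mk σ)).hodge (p, q) =
      (Bℂ.hodge (hbc σ hX) i).hodgeNumber p q) ∧
    ∀ σ : K →+* ℂ, (InfinitePlace.mk σ).IsReal →
      ∀ p : ℤ, (D.gammaData (InfinitePlace.mk σ)).hPlus p = S.hPlus σ hX i p

/-- Two Hasse–Weil data matching the same `(E, Bℂ, S, X, i)` have the same archimedean
`Γ`-factor: at complex places `gammaFactorComplex` depends only on the Hodge numbers, and at
real places `gammaFactorReal` depends on the Hodge numbers and `h^{p,+}` (both pinned) and on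
`h^{p,-} = h^{p,p} - h^{p,+}` (sum rule). This is the point of the parameter `S`
(Serre 1970, §3.2). Proved (every infinite place is `InfinitePlace.mk σ`,
`InfinitePlace.mk_embedding`). [cite: Serre1970, §3.2] -/
theorem IsHasseWeilDataFor.gammaFactor_eq {hbc : IsSmoothProjective.baseChangeHom (k := K) (L := ℂ)}
    {E : ∀ (ℓ : ℕ) [Fact ℓ.Prime], EtaleRealization K ℓ}
    {Bℂ : BettiHodgeData ℂ} {S : ArchSignData K} {n : ℕ} {X : SchemeOver K}
    {hX : IsSmoothProjective n X} {i : ℕ} {D D' : HasseWeilData K}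
    (hD : IsHasseWeilDataFor hbc E Bℂ S X hX i D) (hD' : IsHasseWeilDataFor hbc E Bℂ S X hX i D') :
    D.gammaFactor = D'.gammaFactor := by
  obtain ⟨-, -, -, hH, hP⟩ := hD
  obtain ⟨-, -, -, hH', hP'⟩ := hD'
  have hodge_eq : ∀ w : InfinitePlace K, (D.gammaData w).hodge = (D'.gammaData w).hodge := by
    intro w
    ext ⟨p, q⟩
    rw [← InfinitePlace.mk_embedding w, hH, hH']
  funext s
  unfold HasseWeilData.gammaFactor
  refine Finset.prod_congr rfl fun w _ ↦ ?_
  split_ifs with hw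
  · have hw' : (InfinitePlace.mk w.embedding).IsReal := by rwa [InfinitePlace.mk_embedding]
    have hPlus_eq : (D.gammaData w).hPlus = (D'.gammaData w).hPlus := by
      ext p
      have h₁ := hP w.embedding hw' p
      have h₂ := hP' w.embedding hw' p
      rw [InfinitePlace.mk_embedding] at h₁ h₂
      rw [h₁, h₂]
    have hMinus_eq : (D.gammaData w).hMinus = (D'.gammaData w).hMinus := by
      ext p
      have h₁ := (D.gammaData w).hPlus_add_hMinus p
      have h₂ := (D'.gammaData w).hPlus_add_hMinus p
      rw [hodge_eq w, hPlus_eq, ← h₂] at h₁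
      exact Nat.add_left_cancel h₁
    simp only [HodgeGammaDatum.gammaFactorReal, hodge_eq w, hPlus_eq, hMinus_eq]
  · simp only [HodgeGammaDatum.gammaFactorComplex, hodge_eq w]

end Matching

end Literature.AlgebraicGeometry.Motives

end
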